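import Literature.NumberTheory.Automorphic.ModularLambdaDescent
import Literature.Analysis.Complex.AnalyticFormalRoots
import Mathlib.Analysis.Calculus.Deriv.Inverse
import HarnessLib

/-!
# Galois conjugation of modular functions, I: local roots of the conjugate polynomial

Calegari–Dimitrov–Tang, *The unbounded denominators conjecture* (J. Amer. Math. Soc. **38**
(2025), arXiv:2109.09040), Remark 59, use as an input to Voight's trace argument that "the
absolute Galois group `Gal(ℚ̄/ℚ)` acts on the `q`-expansions of modular forms" for possibly
NONCONGRUENCE subgroups of `SL(2, ℤ)` — a statement whose classical proof needs the algebraic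
model of a noncongruence modular curve. This is the first of the files giving an ANALYTIC proof.
The set-up (`ModularFunctionOrbitPolynomial.lean`): a finite `Γ(2)`-stable set `O` of holomorphic
functions on `ℍ` and its orbit polynomial `𝒫 ∈ ℂ[X][Y]`,
`𝒫(λ(τ), Y) = (λ(τ)(1 − λ(τ)))^M ∏_{Φ ∈ O} (Y − Φ(τ))`. For a field automorphism `σ` of `ℂ` let
`𝒬 = 𝒫^σ` (`σ` applied to the coefficients). The main result of this file,
**`exists_local_roots_conjugate`**, says that `𝒬` is again unramified over `ℂ ∖ {0, 1}`: near
every `a' ∈ ℂ ∖ {0, 1}` there are `#O` holomorphic functions `y_Φ(t)` with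
`𝒬(a' + t, Y) = ((a' + t)(1 − a' − t))^M ∏_Φ (Y − y_Φ(t))` for `|t|` small.

Proof: at `a = σ⁻¹(a') = λ(τ_a)` invert `λ` locally (`λ' ≠ 0`,
`exists_localInverse_modularLambda`); the roots `Φ(ψ(a + t))` of `𝒫(a + t, ·)` have Taylor series
`𝔶_Φ ∈ ℂ⟦t⟧`, pairwise distinct, with `𝒫(a + t, Y) = lead · ∏ (Y − 𝔶_Φ)` formally
(`taylor_coeff_C_mul_prod_X_sub_C`); applying `σ` coefficientwise gives `#O` distinct — hence
simple — formal roots of `𝒬(a' + t, ·)`, which are jets of holomorphic roots by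
`Literature.Analysis.Complex.FormalRoot.exists_holomorphic_root_of_formal_root`; distinct germs
of roots of a polynomial of degree `#O` give the factorisation on a punctured neighbourhood,
and at `t = 0` by continuity.

No definitions, no named facts.

## References

* [CalegariDimitrovTang2025] arXiv:2109.09040, Remark 59; §1 p. 3 ("`f` is an algebraic function
  of `λ`, with branching only at `λ = 0, 1, ∞`").
-/

noncomputable section

open Complex Filter Topology Function Metric Set Polynomial
open UpperHalfPlane hiding I
open scoped Real Topology MatrixGroups Manifold Nat

namespace Literature.NumberTheory.Automorphic

namespace ModularLambda

open Literature.NumberTheory.Transcendental.AndreCriterion (coeff_taylor constantCoeff_taylor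
  taylor_congr taylor_add taylor_sum taylor_const_mul taylor_mul taylor_one taylor_pow)
open Literature.Analysis.Complex.FormalRoot

/-- The Taylor series of `f : ℂ → ℂ` at `0`, as a formal power series (local notation, as in
`AndreCriterionAnalyticProofs`). -/
local notation3 "𝓣[" f "]" =>
  (PowerSeries.mk fun n => ((Nat.factorial n : ℂ)⁻¹ * iteratedDeriv n f 0) : PowerSeries ℂ)

/-! ### A local holomorphic inverse of `λ` -/

/-- **Local holomorphic inverse of `λ`.** For `Im τ₀ > 0` there are `ρ > 0` and `ψ` holomorphic
on `|x − λ(τ₀)| < ρ` with `ψ(λ(τ₀)) = τ₀`, `Im ψ > 0`, `λ ∘ ψ = id` there, and `ψ ∘ λ = id`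
near `τ₀` (`λ' ≠ 0`, inverse function theorem). [folklore] -/
theorem exists_localInverse_modularLambda {τ₀ : ℂ} (hτ₀ : 0 < τ₀.im) :
    ∃ ρ > 0, ∃ ψ : ℂ → ℂ, DifferentiableOn ℂ ψ (ball (modularLambda τ₀) ρ) ∧
      ψ (modularLambda τ₀) = τ₀ ∧
      (∀ x ∈ ball (modularLambda τ₀) ρ, 0 < (ψ x).im ∧ modularLambda (ψ x) = x) ∧
      ∀ᶠ τ in 𝓝 τ₀, ψ (modularLambda τ) = τ := by
  have hsd := hasStrictDerivAt_modularLambda hτ₀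
  have hne := deriv_modularLambda_ne_zero hτ₀
  set e := (hsd.hasStrictFDerivAt_equiv hne).toOpenPartialHomeomorph modularLambda with he
  have hecoe : (e : ℂ → ℂ) = modularLambda :=
    (hsd.hasStrictFDerivAt_equiv hne).toOpenPartialHomeomorph_coe
  have hsrc : τ₀ ∈ e.source := (hsd.hasStrictFDerivAt_equiv hne).mem_toOpenPartialHomeomorph_source
  have htgt : modularLambda τ₀ ∈ e.target := by
    have := (hsd.hasStrictFDerivAt_equiv hne).image_mem_toOpenPartialHomeomorph_target
    exact this
  set ψ : ℂ → ℂ := fun x ↦ e.symm x with hψ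
  have hψ0 : ψ (modularLambda τ₀) = τ₀ := by
    have := e.left_inv hsrc
    rwa [hecoe] at this
  -- continuity of `ψ` on the (open) target, right inverse on the target
  have hcont : ∀ x ∈ e.target, ContinuousAt ψ x := fun x hx ↦
    e.continuousOn_symm.continuousAt (e.open_target.mem_nhds hx)
  have hright : ∀ x ∈ e.target, modularLambda (ψ x) = x := fun x hx ↦ by
    have := e.right_inv hx
    rwa [hecoe] at this
  -- a ball inside the target on which `Im ψ > 0`
  have hpos : ∀ᶠ x in 𝓝 (modularLambda τ₀), 0 < (ψ x).im := by
    have hc : ContinuousAt ψ (modularLambda τ₀) := hcont _ htgt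
    have : ∀ᶠ x in 𝓝 (modularLambda τ₀), ψ x ∈ {z : ℂ | 0 < z.im} := by
      refine hc.preimage_mem_nhds ?_
      rw [hψ0]
      exact (isOpen_lt continuous_const Complex.continuous_im).mem_nhds hτ₀
    exact this
  have htgt' : ∀ᶠ x in 𝓝 (modularLambda τ₀), x ∈ e.target := e.open_target.mem_nhds htgt
  obtain ⟨ρ, hρ, hball⟩ := Metric.eventually_nhds_iff_ball.mp (hpos.and htgt')
  refine ⟨ρ, hρ, ψ, fun x hx ↦ ?_, hψ0, fun x hx ↦ ⟨(hball x hx).1, hright x (hball x hx).2⟩, ?_⟩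
  · -- differentiability at `x`, from `λ ∘ ψ = id` near `x` and `λ'(ψ x) ≠ 0`
    obtain ⟨hxpos, hxt⟩ := hball x hx
    have hev : ∀ᶠ y in 𝓝 x, modularLambda (ψ y) = y := by
      filter_upwards [e.open_target.mem_nhds hxt] with y hy using hright y hy
    have hd : HasDerivAt ψ (deriv modularLambda (ψ x))⁻¹ x :=
      HasDerivAt.of_local_left_inverse (hcont x hxt)
        (differentiableAt_modularLambda hxpos).hasDerivAt (deriv_modularLambda_ne_zero hxpos) hev
    exact hd.differentiableAt.differentiableWithinAt
  · filter_upwards [e.open_source.mem_nhds hsrc] with τ hτ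
    have := e.left_inv hτ
    rwa [hecoe] at this

/-! ### Transforms of coefficients of `C c · ∏ (X − C gᵢ)` -/

/-- Coefficient recursion for `(X − C c) p`. [folklore] -/
theorem coeff_X_sub_C_mul' {R : Type*} [CommRing R] (c : R) (p : R[X]) (n : ℕ) :
    ((X - C c) * p).coeff n = (if n = 0 then 0 else p.coeff (n - 1)) - c * p.coeff n := by
  rw [sub_mul, coeff_sub, coeff_C_mul]
  rcases n with _ | n
  · rw [coeff_X_mul_zero, if_pos rfl]
  · rw [coeff_X_mul, if_neg (Nat.succ_ne_zero n), Nat.succ_sub_one]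

/-- **A ring homomorphism on "good" functions commutes with the coefficients of
`C c · ∏ᵢ (X − C gᵢ)`.** Abstract version (used for the Taylor series of germs and for
`q`-expansions of periodic functions): `Good` is closed under products, `T` is multiplicative
and subtractive on good functions and kills `0`. [folklore] -/
theorem transform_coeff_C_mul_prod_X_sub_C {α S : Type*} [CommRing S] {ι : Type*}
    (Good : (α → ℂ) → Prop) (T : (α → ℂ) → S)
    (hmul : ∀ f g, Good f → Good g → Good (f * g) ∧ T (f * g) = T f * T g)
    (hsub : ∀ f g, Good f → Good g → Good (f - g) ∧ T (f - g) = T f - T g)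
    (hzero : Good 0 ∧ T 0 = 0)
    {c : α → ℂ} (hc : Good c) {g : ι → α → ℂ} (s : Finset ι) (hg : ∀ i ∈ s, Good (g i)) (n : ℕ) :
    Good (fun x ↦ (C (c x) * ∏ i ∈ s, (X - C (g i x))).coeff n) ∧
      T (fun x ↦ (C (c x) * ∏ i ∈ s, (X - C (g i x))).coeff n) =
        (C (T c) * ∏ i ∈ s, (X - C (T (g i)))).coeff n := by
  classical
  induction s using Finset.induction_on generalizing n with
  | empty =>
    simp only [Finset.prod_empty, mul_one, coeff_C]
    split_ifs
    · exact ⟨hc, rfl⟩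
    · exact hzero
  | insert a s ha ih =>
    have hga : Good (g a) := hg a (Finset.mem_insert_self a s)
    have hgs : ∀ i ∈ s, Good (g i) := fun i hi ↦ hg i (Finset.mem_insert_of_mem hi)
    simp only [Finset.prod_insert ha]
    have hfun : (fun x ↦ (C (c x) * ((X - C (g a x)) * ∏ i ∈ s, (X - C (g i x)))).coeff n) =
        (fun x ↦ (if n = 0 then (0 : ℂ) else (C (c x) * ∏ i ∈ s, (X - C (g i x))).coeff (n - 1))) -
          g a * fun x ↦ (C (c x) * ∏ i ∈ s, (X - C (g i x))).coeff n := by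
      funext x
      simp only [Pi.sub_apply, Pi.mul_apply]
      rw [mul_left_comm, coeff_X_sub_C_mul']
    rw [hfun, mul_left_comm (C (T c)), coeff_X_sub_C_mul']
    obtain ⟨hgood₁, hT₁⟩ := ih hgs n
    have hfirst : Good (fun x ↦ (if n = 0 then (0 : ℂ) else
        (C (c x) * ∏ i ∈ s, (X - C (g i x))).coeff (n - 1))) ∧
        T (fun x ↦ (if n = 0 then (0 : ℂ) else
          (C (c x) * ∏ i ∈ s, (X - C (g i x))).coeff (n - 1))) =
          (if n = 0 then 0 else (C (T c) * ∏ i ∈ s, (X - C (T (g i)))).coeff (n - 1)) := by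
      by_cases h0 : n = 0
      · simp only [h0, if_true]
        exact ⟨hzero.1, hzero.2⟩
      · simp only [h0, if_false]
        exact ih hgs (n - 1)
    obtain ⟨hgood₂, hT₂⟩ := hmul _ _ hga hgood₁
    obtain ⟨hgood₃, hT₃⟩ := hsub _ _ hfirst.1 hgood₂
    refine ⟨hgood₃, ?_⟩
    rw [hT₃, hfirst.2, hT₂, hT₁]

/-- Taylor series version: for `c, gᵢ` analytic at `0`, the Taylor series of the coefficients of
`C c(t) · ∏ (X − C gᵢ(t))` are the coefficients of `C 𝓣[c] · ∏ (X − C 𝓣[gᵢ])`, and these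
coefficient functions are analytic at `0`. [folklore] -/
theorem taylor_coeff_C_mul_prod_X_sub_C {ι : Type*} {c : ℂ → ℂ} (hc : AnalyticAt ℂ c 0)
    {g : ι → ℂ → ℂ} (s : Finset ι) (hg : ∀ i ∈ s, AnalyticAt ℂ (g i) 0) (n : ℕ) :
    AnalyticAt ℂ (fun t ↦ (C (c t) * ∏ i ∈ s, (X - C (g i t))).coeff n) 0 ∧
      𝓣[fun t ↦ (C (c t) * ∏ i ∈ s, (X - C (g i t))).coeff n] =
        (C 𝓣[c] * ∏ i ∈ s, (X - C 𝓣[g i])).coeff n := by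
  refine transform_coeff_C_mul_prod_X_sub_C (fun f : ℂ → ℂ ↦ AnalyticAt ℂ f 0)
    (fun f ↦ 𝓣[f]) (fun f g hf hg ↦ ⟨hf.mul hg, taylor_mul hf hg⟩)
    (fun f g hf hg ↦ ⟨hf.sub hg, taylor_sub hf hg⟩) ⟨analyticAt_const, ?_⟩ hc s hg n
  ext m
  rw [coeff_taylor, map_zero]
  simp

/-- Differentiability of the coefficients of `C c(t) · ∏ (X − C gᵢ(t))` on a set. [folklore] -/
theorem differentiableOn_coeff_C_mul_prod_X_sub_C {ι : Type*} {U : Set ℂ} {c : ℂ → ℂ}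
    (hc : DifferentiableOn ℂ c U) {g : ι → ℂ → ℂ} (s : Finset ι)
    (hg : ∀ i ∈ s, DifferentiableOn ℂ (g i) U) (n : ℕ) :
    DifferentiableOn ℂ (fun t ↦ (C (c t) * ∏ i ∈ s, (X - C (g i t))).coeff n) U := by
  classical
  induction s using Finset.induction_on generalizing n with
  | empty =>
    simp only [Finset.prod_empty, mul_one, coeff_C]
    split_ifs
    · exact hc
    · exact differentiableOn_const _
  | insert a s ha ih =>
    have hgs : ∀ i ∈ s, DifferentiableOn ℂ (g i) U := fun i hi ↦ hg i (Finset.mem_insert_of_mem hi)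
    simp only [Finset.prod_insert ha]
    have hfun : (fun t ↦ (C (c t) * ((X - C (g a t)) * ∏ i ∈ s, (X - C (g i t)))).coeff n) =
        fun t ↦ (if n = 0 then (0 : ℂ) else (C (c t) * ∏ i ∈ s, (X - C (g i t))).coeff (n - 1)) -
          g a t * (C (c t) * ∏ i ∈ s, (X - C (g i t))).coeff n := by
      funext t
      rw [mul_left_comm, coeff_X_sub_C_mul']
    rw [hfun]
    refine DifferentiableOn.sub ?_ ((hg a (Finset.mem_insert_self a s)).mul (ih hgs n))
    split_ifs
    · exact differentiableOn_const _
    · exact ih hgs (n - 1)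

/-! ### Polynomials over `ℂ⟦X⟧` obtained from `ℂ[X][Y]` by shifting and mapping

(That the coercion `ℂ[X] → ℂ⟦X⟧` commutes with `map` is Mathlib's
`Polynomial.polynomial_map_coe`.) -/

/-- The Taylor series at `0` of `t ↦ p(a + t)` is the polynomial `p(X + a)`. [folklore] -/
theorem taylor_eval_add (p : ℂ[X]) (a : ℂ) :
    𝓣[fun t ↦ p.eval (a + t)] = ((p.comp (X + C a) : ℂ[X]) : PowerSeries ℂ) := by
  have : (fun t ↦ p.eval (a + t)) = fun t ↦ (p.comp (X + C a)).eval t := by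
    funext t
    rw [eval_comp, eval_add, eval_X, eval_C, add_comm]
  rw [this, taylor_polynomial]

/-! ### From a formal factorization to holomorphic local roots -/

/-- **Local holomorphic roots from a formal factorization.** Let `Q ∈ ℂ[X][Y]` have `Y`-degree
`≤ #ι` and `Y^{#ι}`-coefficient `c` with `c(a') ≠ 0`, and suppose that formally at `a'`
`Q(a' + t, Y) = c(a' + t) ∏ᵢ (Y − rᵢ)` with pairwise distinct `rᵢ ∈ ℂ⟦t⟧`. Then the `rᵢ` are the
Taylor series of holomorphic functions `yᵢ` on some `|t| < ε` with
`Q(a' + t, Y) = c(a' + t) ∏ᵢ (Y − yᵢ(t))` for all `|t| < ε`. [folklore] -/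
theorem exists_local_roots_of_formal_factorization {ι : Type*} [Fintype ι] [DecidableEq ι]
    [Nonempty ι] {Q : Polynomial ℂ[X]} {c : ℂ[X]} {a' : ℂ}
    (hdeg : Q.natDegree ≤ Fintype.card ι) (htop : Q.coeff (Fintype.card ι) = c)
    (hc : c.eval a' ≠ 0) {r : ι → PowerSeries ℂ} (hr : Function.Injective r)
    (hfact : ∀ n, ((Q.coeff n).comp (X + C a') : PowerSeries ℂ) =
      (C ((c.comp (X + C a') : ℂ[X]) : PowerSeries ℂ) * ∏ i, (X - C (r i))).coeff n) :
    ∃ ε > 0, ∃ y : ι → ℂ → ℂ, (∀ i, DifferentiableOn ℂ (y i) (ball 0 ε)) ∧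
      (∀ i, 𝓣[y i] = r i) ∧
      ∀ t ∈ ball (0 : ℂ) ε, Q.map (evalRingHom (a' + t)) =
        C (c.eval (a' + t)) * ∏ i, (X - C (y i t)) := by
  classical
  set d : ℕ := Fintype.card ι with hd
  -- ### separation order of the distinct formal roots
  have hsep0 : ∀ p : ι × ι, ∃ n : ℕ, p.1 ≠ p.2 →
      PowerSeries.coeff n (r p.1) ≠ PowerSeries.coeff n (r p.2) := by
    rintro ⟨i, j⟩
    by_cases hij : i = j
    · exact ⟨0, fun h ↦ absurd hij h⟩
    · have hne : r i ≠ r j := fun h ↦ hij (hr h)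
      obtain ⟨n, hn⟩ : ∃ n, PowerSeries.coeff n (r i) ≠ PowerSeries.coeff n (r j) := by
        by_contra hall
        push Not at hall
        exact hne (PowerSeries.ext hall)
      exact ⟨n, fun _ ↦ hn⟩
  choose nsep hnsep using hsep0
  set N₀ : ℕ := Finset.univ.sup nsep with hN₀
  have hsep : ∀ i j, i ≠ j → nsep (i, j) ≤ N₀ ∧
      PowerSeries.coeff (nsep (i, j)) (r i) ≠ PowerSeries.coeff (nsep (i, j)) (r j) :=
    fun i j hij ↦ ⟨Finset.le_sup (Finset.mem_univ (i, j)), hnsep (i, j) hij⟩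
  -- ### the coefficient functions and the formal polynomial
  set b : ℕ → ℂ → ℂ := fun n t ↦ (Q.coeff n).eval (a' + t) with hb
  have hbd : ∀ n, Differentiable ℂ (b n) := fun n ↦ by
    simp only [hb]; fun_prop
  have hTb : ∀ n, 𝓣[b n] = ((Q.coeff n).comp (X + C a') : PowerSeries ℂ) := fun n ↦
    taylor_eval_add _ _
  set L : PowerSeries ℂ := ((c.comp (X + C a') : ℂ[X]) : PowerSeries ℂ) with hL
  set QT : Polynomial (PowerSeries ℂ) := C L * ∏ i, (X - C (r i)) with hQT
  have hL0 : L ≠ 0 := by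
    intro h
    have := congrArg PowerSeries.constantCoeff h
    rw [hL, map_zero, ← PowerSeries.coeff_zero_eq_constantCoeff_apply, Polynomial.coeff_coe,
      Polynomial.coeff_zero_eq_eval_zero, eval_comp, eval_add, eval_X, eval_C, zero_add] at this
    exact hc this
  have hQTdeg : QT.natDegree ≤ d := by
    rw [hQT]
    refine (natDegree_C_mul_le _ _).trans ?_
    rw [natDegree_finsetProd_X_sub_C_eq_card, Finset.card_univ]
  have hQT0 : QT ≠ 0 :=
    mul_ne_zero (by rwa [Ne, Polynomial.C_eq_zero]) (monic_prod_X_sub_C _ _).ne_zero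
  have hQTroot : ∀ i, QT.eval (r i) = 0 := fun i ↦ by
    rw [hQT, eval_mul, eval_prod, Finset.prod_eq_zero (Finset.mem_univ i) (by simp), mul_zero]
  have hQTcoef : ∀ n ∈ Finset.range (d + 1), QT.coeff n = 𝓣[b n] := fun n _ ↦ by
    rw [hTb, hfact n]
  have hQTsimple : ∀ i, (Polynomial.derivative QT).eval (r i) ≠ 0 :=
    (roots_eq_and_derivative_eval_ne_zero hQT0 hr (hd ▸ hQTdeg) hQTroot).2
  -- ### holomorphic roots with prescribed jets (convergence of the formal roots)
  have hF3 : ∀ i, ∃ K ≥ N₀ + 1, ∃ ε > 0, ε ≤ 1 ∧ ∃ y : ℂ → ℂ, DifferentiableOn ℂ y (ball 0 ε) ∧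
      (∀ z ∈ ball (0 : ℂ) ε, ∑ n ∈ Finset.range (d + 1), b n z * y z ^ n = 0) ∧
      ∀ n < K, PowerSeries.coeff n 𝓣[y] = PowerSeries.coeff n (r i) := fun i ↦
    exists_holomorphic_root_of_formal_root one_pos (fun n _ ↦ (hbd n).differentiableOn) QT hQTdeg
      hQTcoef (hQTroot i) (hQTsimple i) (N₀ + 1)
  choose K hK ε hε _hε1 y hyd hyroot hyjet using hF3
  set ε₀ : ℝ := Finset.univ.inf' Finset.univ_nonempty ε with hε₀
  have hε₀pos : 0 < ε₀ := by
    rw [hε₀, Finset.lt_inf'_iff]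
    exact fun i _ ↦ hε i
  have hε₀le : ∀ i, ε₀ ≤ ε i := fun i ↦ Finset.inf'_le _ (Finset.mem_univ i)
  have hyd₀ : ∀ i, DifferentiableOn ℂ (y i) (ball 0 ε₀) := fun i ↦
    (hyd i).mono (ball_subset_ball (hε₀le i))
  have hyA : ∀ i, AnalyticAt ℂ (y i) 0 := fun i ↦ analyticAt_of_differentiableOn_ball hε₀pos (hyd₀ i)
  -- ### distinct germs: distinct values on a punctured neighbourhood
  have hgerm : ∀ i j, i ≠ j → ∀ᶠ t in 𝓝[≠] (0 : ℂ), y i t ≠ y j t := by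
    intro i j hij
    rcases ((hyA i).sub (hyA j)).eventually_eq_zero_or_eventually_ne_zero with h0 | h0
    · exfalso
      obtain ⟨hle, hne⟩ := hsep i j hij
      have heq : 𝓣[y i] = 𝓣[y j] := by
        apply taylor_congr
        filter_upwards [h0] with t ht
        simpa [sub_eq_zero] using ht
      have h1 := hyjet i (nsep (i, j)) (by have := hK i; omega)
      have h2 := hyjet j (nsep (i, j)) (by have := hK j; omega)
      rw [heq] at h1
      exact hne (h1.symm.trans h2)
    · filter_upwards [h0] with t ht
      simpa [sub_eq_zero] using ht
  have hgermall : ∀ᶠ t in 𝓝[≠] (0 : ℂ), ∀ p : ι × ι, p.1 ≠ p.2 → y p.1 t ≠ y p.2 t := by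
    rw [Filter.eventually_all]
    rintro ⟨i, j⟩
    by_cases hij : i = j
    · exact Filter.Eventually.of_forall fun t h ↦ absurd hij h
    · filter_upwards [hgerm i j hij] with t ht using fun _ ↦ ht
  -- ### the factorization on a punctured neighbourhood
  have hc' : ∀ᶠ t in 𝓝 (0 : ℂ), c.eval (a' + t) ≠ 0 := by
    have hcont : ContinuousAt (fun t : ℂ ↦ c.eval (a' + t)) 0 := by fun_prop
    exact hcont.eventually_ne (by simpa using hc)
  have hball₀ : ∀ᶠ t in 𝓝 (0 : ℂ), t ∈ ball (0 : ℂ) ε₀ := ball_mem_nhds 0 hε₀pos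
  have hpunct : ∀ᶠ t in 𝓝[≠] (0 : ℂ), Q.map (evalRingHom (a' + t)) =
      C (c.eval (a' + t)) * ∏ i, (X - C (y i t)) := by
    filter_upwards [hgermall, eventually_nhdsWithin_of_eventually_nhds hc',
      eventually_nhdsWithin_of_eventually_nhds hball₀] with t hdist hct hbt
    set q : ℂ[X] := Q.map (evalRingHom (a' + t)) with hq
    have hqcoeff : ∀ n, q.coeff n = b n t := fun n ↦ by
      rw [hq, Polynomial.coeff_map, coe_evalRingHom]
    have hqd : q.coeff d = c.eval (a' + t) := by rw [hqcoeff, hb]; simp only [htop]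
    have hqdeg : q.natDegree ≤ d := (natDegree_map_le).trans hdeg
    have hqdeg' : q.natDegree = d := natDegree_eq_of_le_of_coeff_ne_zero hqdeg (by rwa [hqd])
    have hq0 : q ≠ 0 := fun h ↦ hct (by rw [← hqd, h, coeff_zero])
    have hinj : Function.Injective fun i ↦ y i t := fun i j h ↦ by
      by_contra hij
      exact hdist (i, j) hij h
    have hroots : ∀ i, q.eval (y i t) = 0 := fun i ↦ by
      rw [eval_eq_sum_range' (n := d + 1) (by omega)]
      simp only [hqcoeff]
      exact hyroot i t (ball_subset_ball (hε₀le i) hbt)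
    obtain ⟨hrts, -⟩ := roots_eq_and_derivative_eval_ne_zero hq0 hinj (by rw [hqdeg']) hroots
    have hcardroots : Multiset.card q.roots = q.natDegree := by
      rw [hrts, Finset.map_val, Multiset.card_map, Finset.card_val, Finset.card_univ, hqdeg']
    have h := C_leadingCoeff_mul_prod_multiset_X_sub_C hcardroots
    rw [Polynomial.leadingCoeff, hqdeg', hqd, hrts, Finset.map_val, Multiset.map_map] at h
    rw [← h]
    congr 1
  -- ### extension to `t = 0` by continuity of the coefficients
  have hcoefev : ∀ m, ∀ᶠ t in 𝓝 (0 : ℂ), (Q.map (evalRingHom (a' + t))).coeff m =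
      (C (c.eval (a' + t)) * ∏ i, (X - C (y i t))).coeff m := by
    intro m
    set fm : ℂ → ℂ := fun t ↦ (Q.map (evalRingHom (a' + t))).coeff m -
      (C (c.eval (a' + t)) * ∏ i, (X - C (y i t))).coeff m with hfm
    have hfmc : ContinuousAt fm 0 := by
      have h1 : DifferentiableOn ℂ (fun t : ℂ ↦ (Q.map (evalRingHom (a' + t))).coeff m) (ball 0 ε₀) := by
        have : (fun t : ℂ ↦ (Q.map (evalRingHom (a' + t))).coeff m) = b m := by
          funext t; rw [Polynomial.coeff_map, coe_evalRingHom]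
        rw [this]; exact (hbd m).differentiableOn
      have h2 : DifferentiableOn ℂ
          (fun t : ℂ ↦ (C (c.eval (a' + t)) * ∏ i, (X - C (y i t))).coeff m) (ball 0 ε₀) :=
        differentiableOn_coeff_C_mul_prod_X_sub_C (by fun_prop) Finset.univ (fun i _ ↦ hyd₀ i) m
      exact ((h1.sub h2).differentiableAt (ball_mem_nhds 0 hε₀pos)).continuousAt
    have hfm0 : fm 0 = 0 := by
      have hpw : fm =ᶠ[𝓝[≠] (0 : ℂ)] fun _ ↦ 0 := by
        filter_upwards [hpunct] with t ht
        simp only [hfm, ht, sub_self]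
      have h1 : Tendsto fm (𝓝[≠] (0 : ℂ)) (𝓝 (fm 0)) := hfmc.tendsto.mono_left nhdsWithin_le_nhds
      have h2 : Tendsto fm (𝓝[≠] (0 : ℂ)) (𝓝 0) := tendsto_const_nhds.congr' hpw.symm
      exact tendsto_nhds_unique h1 h2
    have hall : ∀ᶠ t in 𝓝 (0 : ℂ), t ≠ 0 → fm t = 0 := by
      have := hpunct
      rw [eventually_nhdsWithin_iff] at this
      filter_upwards [this] with t ht h0
      simp only [hfm, ht h0, sub_self]
    filter_upwards [hall] with t ht
    by_cases h0 : t = 0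
    · subst h0; exact sub_eq_zero.mp hfm0
    · exact sub_eq_zero.mp (ht h0)
  have hfinal : ∀ᶠ t in 𝓝 (0 : ℂ), Q.map (evalRingHom (a' + t)) =
      C (c.eval (a' + t)) * ∏ i, (X - C (y i t)) := by
    have hlow : ∀ᶠ t in 𝓝 (0 : ℂ), ∀ m ∈ Finset.range (d + 1),
        (Q.map (evalRingHom (a' + t))).coeff m = (C (c.eval (a' + t)) * ∏ i, (X - C (y i t))).coeff m :=
      (Filter.eventually_all_finset _).mpr fun m _ ↦ hcoefev m
    filter_upwards [hlow] with t ht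
    apply Polynomial.ext
    intro m
    by_cases hm : m ∈ Finset.range (d + 1)
    · exact ht m hm
    · have hm' : d < m := by rw [Finset.mem_range] at hm; omega
      rw [coeff_eq_zero_of_natDegree_lt ((natDegree_map_le).trans hdeg |>.trans_lt hm'),
        coeff_eq_zero_of_natDegree_lt]
      calc (C (c.eval (a' + t)) * ∏ i, (X - C (y i t))).natDegree
          ≤ (∏ i, (X - C (y i t)) : ℂ[X]).natDegree := natDegree_C_mul_le _ _
        _ = d := by rw [natDegree_finsetProd_X_sub_C_eq_card, Finset.card_univ]
        _ < m := hm'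
  obtain ⟨ε₁, hε₁, hε₁ball⟩ := Metric.eventually_nhds_iff_ball.mp hfinal
  -- ### the full Taylor series of the roots
  have hTy : ∀ i, 𝓣[y i] = r i := by
    intro i
    -- `𝓣[y i]` is a formal root of `QT`
    have hbA : ∀ n, AnalyticAt ℂ (b n) 0 := fun n ↦ (hbd n).analyticAt 0
    have hyn : ∀ n : ℕ, AnalyticAt ℂ (y i ^ n) 0 := fun n ↦ (hyA i).pow n
    have hzero : 𝓣[∑ n ∈ Finset.range (d + 1), (b n * y i ^ n)] = 0 := by
      rw [taylor_eq_zero_iff (Finset.analyticAt_sum _ fun n _ ↦ (hbA n).mul (hyn n))]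
      filter_upwards [ball_mem_nhds (0 : ℂ) (hε i)] with t ht
      simp only [Finset.sum_apply, Pi.mul_apply, Pi.pow_apply, Pi.zero_apply]
      exact hyroot i t ht
    have heval : 𝓣[∑ n ∈ Finset.range (d + 1), (b n * y i ^ n)] = QT.eval 𝓣[y i] := by
      rw [taylor_sum _ (fun n _ ↦ (hbA n).mul (hyn n)),
        eval_eq_sum_range' (n := d + 1) (by omega)]
      refine Finset.sum_congr rfl fun n hn ↦ ?_
      rw [taylor_mul (hbA n) (hyn n), taylor_pow (hyA i), hQTcoef n hn]
    have hroot : QT.eval 𝓣[y i] = 0 := by rw [← heval, hzero]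
    rw [hQT, eval_mul, eval_prod, mul_eq_zero] at hroot
    rcases hroot with hL | hprod
    · rw [eval_C] at hL
      exact absurd hL hL0
    · rw [Finset.prod_eq_zero_iff] at hprod
      obtain ⟨j, -, hj⟩ := hprod
      rw [eval_sub, eval_X, eval_C, sub_eq_zero] at hj
      by_cases hij : i = j
      · subst hij; exact hj
      · exfalso
        obtain ⟨hle, hne⟩ := hsep i j hij
        have h1 := hyjet i (nsep (i, j)) (by have := hK i; omega)
        rw [hj] at h1
        exact hne h1.symm
  exact ⟨min ε₀ ε₁, lt_min hε₀pos hε₁, y,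
    fun i ↦ (hyd₀ i).mono (ball_subset_ball (min_le_left _ _)), hTy,
    fun t ht ↦ hε₁ball t (ball_subset_ball (min_le_right _ _) ht)⟩

/-! ### The main theorem: local holomorphic root systems of the conjugate polynomial -/


/-- **The conjugate of an orbit polynomial is unramified over `ℂ ∖ {0, 1}`.** Let `O` be a
nonempty finite set of holomorphic functions on `ℍ` and `𝒫 ∈ ℂ[X][Y]` a polynomial of
`Y`-degree `≤ #O` with `Y^{#O}`-coefficient `(X(1 − X))^M` and
`𝒫(λ(τ), Y) = (λ(τ)(1 − λ(τ)))^M ∏_{Φ ∈ O} (Y − Φ(τ))` for all `τ ∈ ℍ`. Let `σ` be a field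
automorphism of `ℂ` and `a' ∈ ℂ ∖ {0, 1}`. Then there are `ε > 0` and functions `y_Φ`
(`Φ ∈ O`) holomorphic on `|t| < ε` such that for all `|t| < ε`
`𝒫^σ(a' + t, Y) = ((a' + t)(1 − (a' + t)))^M ∏_{Φ ∈ O} (Y − y_Φ(t))`,
where `𝒫^σ` is `𝒫` with `σ` applied to all coefficients. [cite: CalegariDimitrovTang2025,
Remark 59 (input: Galois conjugates of modular forms), §1 p. 3] -/
theorem exists_local_roots_conjugate {O : Finset (ℍ → ℂ)} (hO : O.Nonempty)
    (hd : ∀ Φ ∈ O, MDiff Φ) {M : ℕ} {Porb : Polynomial ℂ[X]}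
    (hdeg : Porb.natDegree ≤ O.card) (htop : Porb.coeff O.card = (X * (1 - X)) ^ M)
    (hPorb : ∀ τ : ℍ, Porb.map (evalRingHom (modularLambda τ)) =
      C ((modularLambda τ * (1 - modularLambda τ)) ^ M) * ∏ Φ ∈ O, (X - C (Φ τ)))
    (σ : ℂ ≃+* ℂ) {a' : ℂ} (ha'0 : a' ≠ 0) (ha'1 : a' ≠ 1) :
    ∃ ε > 0, ∃ y : (ℍ → ℂ) → ℂ → ℂ, (∀ Φ ∈ O, DifferentiableOn ℂ (y Φ) (ball 0 ε)) ∧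
      ∀ t ∈ ball (0 : ℂ) ε,
        (Porb.map (mapRingHom (σ : ℂ →+* ℂ))).map (evalRingHom (a' + t)) =
          C (((a' + t) * (1 - (a' + t))) ^ M) * ∏ Φ ∈ O, (X - C (y Φ t)) := by
  classical
  set d : ℕ := O.card with hdcard
  set σr : ℂ →+* ℂ := (σ : ℂ →+* ℂ) with hσr
  set Q : Polynomial ℂ[X] := Porb.map (mapRingHom σr) with hQ
  -- ### the point `a = σ⁻¹ a'` and a preimage `τa` under `λ`
  set a : ℂ := σ.symm a' with ha
  have hσa : σ a = a' := σ.apply_symm_apply a'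
  have ha0 : a ≠ 0 := fun h ↦ ha'0 (by rw [← hσa, h, map_zero])
  have ha1 : a ≠ 1 := fun h ↦ ha'1 (by rw [← hσa, h, map_one])
  obtain ⟨τa, hτa, hτalam⟩ := exists_modularLambda_eq ha0 ha1
  -- ### local inverse `ψ` of `λ` near `a`
  obtain ⟨ρ, hρ, ψ, hψd, hψa, hψ, hψleft⟩ := exists_localInverse_modularLambda hτa
  rw [hτalam] at hψd hψa hψ
  -- ### the original roots as functions of `x` near `a`, and of `t = x - a` near `0`
  set yo : (ℍ → ℂ) → ℂ → ℂ := fun Φ t ↦ Φ (ofComplex (ψ (a + t))) with hyo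
  have hOd : ∀ Φ ∈ O, DifferentiableOn ℂ (fun τ : ℂ ↦ Φ (ofComplex τ)) {z : ℂ | 0 < z.im} :=
    fun Φ hΦ ↦ UpperHalfPlane.mdifferentiable_iff.mp (hd Φ hΦ)
  have hshift : ∀ t ∈ ball (0 : ℂ) ρ, a + t ∈ ball a ρ := fun t ht ↦ by
    rw [mem_ball, dist_eq_norm, add_sub_cancel_left]; rwa [mem_ball_zero_iff] at ht
  have hyod : ∀ Φ ∈ O, DifferentiableOn ℂ (yo Φ) (ball 0 ρ) := by
    intro Φ hΦ
    have h1 : DifferentiableOn ℂ (fun t : ℂ ↦ ψ (a + t)) (ball 0 ρ) :=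
      hψd.comp (by fun_prop) hshift
    refine (hOd Φ hΦ).comp h1 fun t ht ↦ ?_
    exact (hψ (a + t) (hshift t ht)).1
  have hyoA : ∀ Φ ∈ O, AnalyticAt ℂ (yo Φ) 0 := fun Φ hΦ ↦
    analyticAt_of_differentiableOn_ball hρ (hyod Φ hΦ)
  -- pointwise factorization of `Porb (a + t, ·)`
  have hfacto : ∀ t ∈ ball (0 : ℂ) ρ, Porb.map (evalRingHom (a + t)) =
      C (((a + t) * (1 - (a + t))) ^ M) * ∏ Φ ∈ O, (X - C (yo Φ t)) := by
    intro t ht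
    obtain ⟨hpos, hlam⟩ := hψ (a + t) (hshift t ht)
    have h := hPorb ⟨ψ (a + t), hpos⟩
    have hcoe : ((⟨ψ (a + t), hpos⟩ : ℍ) : ℂ) = ψ (a + t) := rfl
    rw [hcoe, hlam] at h
    rw [h]
    congr 1
    refine Finset.prod_congr rfl fun Φ _ ↦ ?_
    simp only [hyo, ofComplex_apply_of_im_pos hpos]
  -- ### Taylor series: the formal factorization of `Porb (a + t, ·)`
  set 𝔶 : (ℍ → ℂ) → PowerSeries ℂ := fun Φ ↦ 𝓣[yo Φ] with h𝔶
  set leadA : ℂ → ℂ := fun t ↦ ((a + t) * (1 - (a + t))) ^ M with hleadA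
  have hleadA_an : AnalyticAt ℂ leadA 0 := by
    simp only [hleadA]; fun_prop
  -- coefficientwise: `𝓣[t ↦ (Porb.coeff n)(a + t)] = coeff n (C 𝓣[lead] * ∏ (X - C 𝔶_Φ))`
  have hTcoeff : ∀ n, ((Porb.coeff n).comp (X + C a) : PowerSeries ℂ) =
      (C 𝓣[leadA] * ∏ Φ ∈ O, (X - C (𝔶 Φ))).coeff n := by
    intro n
    have h1 := (taylor_coeff_C_mul_prod_X_sub_C hleadA_an O hyoA n).2
    rw [← taylor_eval_add, ← h1]
    apply taylor_congr
    filter_upwards [ball_mem_nhds (0 : ℂ) hρ] with t ht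
    have := congrArg (fun p : ℂ[X] ↦ p.coeff n) (hfacto t ht)
    simp only [Polynomial.coeff_map, coe_evalRingHom] at this
    exact this
  -- ### distinctness of the formal roots
  have hopen : IsOpen {z : ℂ | 0 < z.im} := isOpen_lt continuous_const Complex.continuous_im
  have hconn : IsPreconnected {z : ℂ | 0 < z.im} := (convex_halfSpace_im_gt 0).isPreconnected
  have h𝔶inj : ∀ Φ ∈ O, ∀ Ψ ∈ O, 𝔶 Φ = 𝔶 Ψ → Φ = Ψ := by
    intro Φ hΦ Ψ hΨ heq
    -- `yo Φ = yo Ψ` near `0`, hence `Φ = Ψ` near `τa`, hence everywhere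
    have hev : yo Φ =ᶠ[𝓝 0] yo Ψ := eventuallyEq_of_taylor_eq (hyoA Φ hΦ) (hyoA Ψ hΨ) heq
    have hev' : (fun τ : ℂ ↦ Φ (ofComplex τ)) =ᶠ[𝓝 τa] fun τ ↦ Ψ (ofComplex τ) := by
      have hct : Tendsto (fun τ : ℂ ↦ modularLambda τ - a) (𝓝 τa) (𝓝 0) := by
        have := (differentiableAt_modularLambda hτa).continuousAt.tendsto.sub_const a
        rwa [hτalam, sub_self] at this
      have h2 := hct.eventually hev
      filter_upwards [h2, hψleft] with τ hτ hτleft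
      simp only [hyo, add_sub_cancel] at hτ
      rwa [hτleft] at hτ
    have hEq : EqOn (fun τ : ℂ ↦ Φ (ofComplex τ)) (fun τ ↦ Ψ (ofComplex τ)) {z : ℂ | 0 < z.im} :=
      ((hOd Φ hΦ).analyticOnNhd hopen).eqOn_of_preconnected_of_eventuallyEq
        ((hOd Ψ hΨ).analyticOnNhd hopen) hconn hτa hev'
    funext z
    have := hEq (show (z : ℂ) ∈ {w : ℂ | 0 < w.im} from z.im_pos)
    simpa [ofComplex_apply] using this
  -- ### transport by `σ`
  set σh : PowerSeries ℂ →+* PowerSeries ℂ := PowerSeries.map σr with hσh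
  have hσh_inj : Function.Injective σh := by
    intro p₁ p₂ h
    ext n
    have := congrArg (PowerSeries.coeff n) h
    simp only [hσh, PowerSeries.coeff_map] at this
    exact σ.injective this
  haveI : Nonempty O := hO.coe_sort
  set r : O → PowerSeries ℂ := fun Φ ↦ σh (𝔶 Φ) with hrdef
  have hrinj : Function.Injective r := fun Φ Ψ h ↦
    Subtype.ext (h𝔶inj Φ Φ.2 Ψ Ψ.2 (hσh_inj h))
  -- the pieces of the conjugate formal factorization
  have hσX : (X + C a : ℂ[X]).map σr = X + C a' := by
    rw [Polynomial.map_add, Polynomial.map_X, Polynomial.map_C, hσr, RingHom.coe_coe, hσa]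
  have hlead_poly : (fun t : ℂ ↦ ((a + t) * (1 - (a + t))) ^ M) =
      fun t ↦ ((X * (1 - X)) ^ M : ℂ[X]).eval (a + t) := by
    funext t
    simp
  have hTlead : 𝓣[leadA] = ((((X * (1 - X)) ^ M : ℂ[X]).comp (X + C a) : ℂ[X]) : PowerSeries ℂ) := by
    rw [hleadA, hlead_poly, taylor_eval_add]
  have hσlead : ((X * (1 - X)) ^ M : ℂ[X]).map σr = (X * (1 - X)) ^ M := by
    simp [Polynomial.map_pow, Polynomial.map_mul, Polynomial.map_sub]
  have hQcoeff : ∀ n, Q.coeff n = (Porb.coeff n).map σr := fun n ↦ by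
    rw [hQ, Polynomial.coeff_map, coe_mapRingHom]
  have hfact : ∀ n, ((Q.coeff n).comp (X + C a') : PowerSeries ℂ) =
      (C ((((X * (1 - X)) ^ M : ℂ[X]).comp (X + C a') : ℂ[X]) : PowerSeries ℂ) *
        ∏ Φ : O, (X - C (r Φ))).coeff n := by
    intro n
    have h := congrArg σh (hTcoeff n)
    -- left-hand side
    rw [← Polynomial.polynomial_map_coe, Polynomial.map_comp, hσX, ← hQcoeff] at h
    rw [h, ← Polynomial.coeff_map, Polynomial.map_mul, Polynomial.map_C, Polynomial.map_prod]
    congr 2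
    · rw [hTlead, ← Polynomial.polynomial_map_coe, Polynomial.map_comp, hσlead, hσX]
    · rw [← Finset.prod_coe_sort O]
      refine Finset.prod_congr rfl fun Φ _ ↦ ?_
      rw [Polynomial.map_sub, Polynomial.map_X, Polynomial.map_C]
  -- ### the local roots of the conjugate polynomial
  have hcard : Fintype.card O = d := Fintype.card_coe O
  have hdegQ : Q.natDegree ≤ Fintype.card O :=
    (natDegree_map_le).trans (by rw [hcard]; exact hdeg)
  have htopQ : Q.coeff (Fintype.card O) = (X * (1 - X)) ^ M := by
    rw [hcard, hQcoeff, hdcard, htop, hσlead]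
  have hc0 : ((X * (1 - X)) ^ M : ℂ[X]).eval a' ≠ 0 := by
    simp only [eval_pow, eval_mul, eval_sub, eval_one, eval_X]
    exact pow_ne_zero _ (mul_ne_zero ha'0 (sub_ne_zero.mpr (Ne.symm ha'1)))
  obtain ⟨ε, hε, y, hyd, -, hyfact⟩ :=
    exists_local_roots_of_formal_factorization hdegQ htopQ hc0 hrinj hfact
  refine ⟨ε, hε, fun Φ ↦ if h : Φ ∈ O then y ⟨Φ, h⟩ else 0, fun Φ hΦ ↦ ?_, fun t ht ↦ ?_⟩
  · simp only [dif_pos hΦ]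
    exact hyd ⟨Φ, hΦ⟩
  · rw [hyfact t ht]
    congr 1
    · simp
    · rw [← Finset.prod_coe_sort O]
      refine Finset.prod_congr rfl fun Φ _ ↦ ?_
      simp only [dif_pos Φ.2]

end ModularLambda

end Literature.NumberTheory.Automorphic
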